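import Literature.MathematicalPhysics.QuantumFieldTheory.Balaban1983to89.Beta.KernelRepresentation

/-!
# Beta / AffineLiftSpec — the hypothesis TYPE `InfiniteVolumeSpec d N` is inhabited at EVERY blocking factor `N ≥ 1`
# by the AFFINE LIFT (zero multipliers); hence the wall's content at `hid` is the kernel identification `hrep`, not the type

HONEST FRAMING (page 1 of everything the β sub-cell writes): discharging `BetaPertH` makes Bałaban's UV stability
UNCONDITIONAL — a real constructive-QFT result; it is NOT the continuum limit and NOT the Clay problem.  This module is
CLASS-LEVEL BOOKKEEPING by the BETA lead (unit `b2b-balaban-strat-b12` gen 8; BETA-SPEC §7.24 (c) (R11-F) v6 / §7.23 (e)(x));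
it asserts nothing printed by Bałaban and cites nothing: every statement is [folklore] linear algebra on `ℤ^d`.

## What and why

an2's `AffineReproduction.InfiniteVolumeSpec d N` (p182451) is the TYPE of the (O1′) hypothesis of the one-loop identity
binder `hid` (RULING (R11-F)): maps `H, Φ, Ψ` on coarse 1-forms with additivity, block-translation covariance, `𝒬 H = id`,
the Euler–Lagrange identity and the weak gauge condition, all ON AFFINE DATA ONLY (`IsAffine`).  an2's `pointSpec` inhabits it
at `N = 1`.  THIS FILE inhabits it at EVERY `N ≥ 1` (`affineLiftSpec N`): `H b :=` the fine AFFINE 1-form whose straight-contour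
block sums are `b` (explicit: linear part `N^{-(d+2)} · m(b)`, constant part solved from `contourSum_affine`), `Φ := 0`, `Ψ := 0`.
All nine fields hold by `AffineAveraging.curvAdj_curv_affine` / `codiff₁_affine_eq` / `contourSum_affine` — affine 1-forms are
stationary with zero multipliers.

CONSEQUENCE FOR THE RECORDS (no grade changes): the TYPE `InfiniteVolumeSpec` carries NO analytic content at any `N`
(lit2-g9's XREAD reading C-lit2g9-4, now a kernel fact); the content of the wall's (O1′)/(D2) item is the READING that
Bałaban's ACTUAL `U = 1` minimiser kernel `w` — the one whose dressed windowed second moments are `μC` in `hident` — gives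
`S.H = kernelOp N w` (`KernelRepresentation`'s hypothesis `hrep`), i.e. that THAT `w` reproduces affine data; a spec ALONE
(without `hrep` to the same `w`) discharges nothing.  Consumers must therefore always pair a spec with `hrep`.

## Contents
* §1 `linPart`/`cstPart` (read a coarse 1-form's affine parameters off its values at `0` and the unit vectors),
  `linPart_affine`, `cstPart_affine`, additivity;
* §2 `contourSum_affine_const` (the constant part of `𝒬 (affine m c)` is `𝒬 (affine m 0) + N^{d+1} c`), the lift
  `affineLift N b`, `affineLift_affine_isAffine`, `contourSum_affineLift` (`𝒬 (lift b) = b` for affine `b`), `affineLift_add`,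
  `affine_add_cst`, `affineLift_trans1`;
* §3 `affineLiftSpec N : InfiniteVolumeSpec d N` for every `N ≥ 1`, and `affineLiftSpec_H` (its `H` is the lift).
-/

noncomputable section

namespace Literature.MathematicalPhysics.QuantumFieldTheory.Balaban1983to89.Beta.AffineLiftSpec

open AffineAveraging (Site Form0 Form1 unitVec unitVec_apply dz curv curvAdj codiff₁ affine box toSite contourSum
  curvAdj_curv_affine codiff₁_affine_eq contourSum_affine)
open AffineReproduction KernelRepresentation

variable {d : ℕ}

/-! ## §1 Reading the affine parameters off a coarse 1-form -/

/-- Linear part read off a 1-form: `m(b) κ l = b_κ(e_l) − b_κ(0)`. [folklore] -/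
def linPart (b : Form1 d ℝ) : Fin d → Fin d → ℝ := fun κ l => b κ (unitVec l) - b κ 0

/-- Constant part read off a 1-form: `c(b) κ = b_κ(0)`. [folklore] -/
def cstPart (b : Form1 d ℝ) : Fin d → ℝ := fun κ => b κ 0

/-- On `affine m c` the linear part is `m`. [folklore] -/
theorem linPart_affine (m : Fin d → Fin d → ℝ) (c : Fin d → ℝ) : linPart (affine m c) = m := by
  funext κ l
  simp [linPart, affine, unitVec_apply, Finset.sum_ite_eq', Finset.mem_univ]

/-- On `affine m c` the constant part is `c`. [folklore] -/
theorem cstPart_affine (m : Fin d → Fin d → ℝ) (c : Fin d → ℝ) : cstPart (affine m c) = c := by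
  funext κ
  simp [cstPart, affine]

/-- `linPart` is additive. [folklore] -/
theorem linPart_add (b b' : Form1 d ℝ) : linPart (b + b') = linPart b + linPart b' := by
  funext κ l
  simp only [linPart, Pi.add_apply]
  ring

/-- `cstPart` is additive. [folklore] -/
theorem cstPart_add (b b' : Form1 d ℝ) : cstPart (b + b') = cstPart b + cstPart b' := by
  funext κ
  simp [cstPart]

/-- `affine` is additive in its parameters. [folklore] -/
theorem affine_add_affine (m m' : Fin d → Fin d → ℝ) (c c' : Fin d → ℝ) :
    affine m c + affine m' c' = affine (m + m') (c + c') := by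
  funext κ x
  simp only [Pi.add_apply, affine, Finset.sum_add_distrib, add_mul]
  ring

/-- `affine m c = affine m 0 + cst c`. [folklore] -/
theorem affine_eq_add_cst (m : Fin d → Fin d → ℝ) (c : Fin d → ℝ) :
    affine m c = affine m 0 + cst c := by
  funext κ x
  simp [affine, cst_apply]

/-! ## §2 The affine lift -/

variable (N : ℕ)

/-- The constant part of `𝒬 (affine m c)` splits as `𝒬 (affine m 0)` plus `N^{d+1} c`. [folklore] -/
theorem contourSum_affine_const (m : Fin d → Fin d → ℝ) (c : Fin d → ℝ) (κ : Fin d) (y : Site d) :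
    contourSum N (affine m c) κ y = contourSum N (affine m 0) κ y + (N : ℝ) ^ (d + 1) * c κ := by
  rw [affine_eq_add_cst m c, contourSum_add, contourSum_cst]
  simp [cst_apply]

/-- Scaled linear part of the lift: `N^{-(d+2)} · m(b)`. [folklore] -/
def liftLin (b : Form1 d ℝ) : Fin d → Fin d → ℝ := fun κ l => ((N : ℝ) ^ (d + 2))⁻¹ * linPart b κ l

/-- Constant part of the lift, solved so that the block sums have constant part `c(b)`. [folklore] -/
def liftCst (b : Form1 d ℝ) : Fin d → ℝ :=
  fun κ => ((N : ℝ) ^ (d + 1))⁻¹ * (cstPart b κ - contourSum N (affine (liftLin N b) 0) κ 0)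

/-- **The affine lift**: the fine affine 1-form whose straight-contour `N`-block sums reproduce the affine coarse 1-form
with the same parameters as `b`. [folklore] -/
def affineLift (b : Form1 d ℝ) : Form1 d ℝ := affine (liftLin N b) (liftCst N b)

/-- The lift is affine. [folklore] -/
theorem isAffine_affineLift (b : Form1 d ℝ) : IsAffine (affineLift N b) := ⟨_, _, rfl⟩

/-- `liftLin` is additive. [folklore] -/
theorem liftLin_add (b b' : Form1 d ℝ) : liftLin N (b + b') = liftLin N b + liftLin N b' := by
  funext κ l
  simp only [liftLin, linPart_add, Pi.add_apply]
  ring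

/-- `liftCst` is additive. [folklore] -/
theorem liftCst_add (b b' : Form1 d ℝ) : liftCst N (b + b') = liftCst N b + liftCst N b' := by
  funext κ
  have h : affine (liftLin N (b + b')) (0 : Fin d → ℝ) = affine (liftLin N b) 0 + affine (liftLin N b') 0 := by
    rw [affine_add_affine, liftLin_add, add_zero]
  simp only [liftCst, cstPart_add, Pi.add_apply, h, contourSum_add]
  ring

/-- The lift is additive (on ALL data). [folklore] -/
theorem affineLift_add (b b' : Form1 d ℝ) : affineLift N (b + b') = affineLift N b + affineLift N b' := by
  simp only [affineLift, liftLin_add, liftCst_add, affine_add_affine]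

/-- **Reproduction**: for affine `b` and `N ≥ 1`, the block sums of the lift are `b`. [folklore] -/
theorem contourSum_affineLift [NeZero N] {b : Form1 d ℝ} (hb : IsAffine b) : contourSum N (affineLift N b) = b := by
  obtain ⟨m, c, rfl⟩ := hb
  have hN : (N : ℝ) ≠ 0 := by exact_mod_cast NeZero.ne N
  have hsm : ((N ^ (d + 2) : ℕ) • liftLin N (affine m c)) = m := by
    funext κ l
    simp only [Pi.smul_apply, liftLin, linPart_affine, nsmul_eq_mul, Nat.cast_pow]
    field_simp
  rw [affineLift, contourSum_affine, hsm]
  congr 1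
  funext κ
  rw [contourSum_affine_const, liftCst, cstPart_affine]
  field_simp
  ring

/-- `affine m c + cst w = affine m (c + w)`. [folklore] -/
theorem affine_add_cst (m : Fin d → Fin d → ℝ) (c w : Fin d → ℝ) : affine m c + cst w = affine m (c + w) := by
  funext κ x
  simp only [Pi.add_apply, affine, cst_apply]
  ring

/-- **Block-translation covariance**: for affine `b`, lifting the translate by `a` is translating the lift by `N a`.
[folklore] -/
theorem affineLift_trans1 [NeZero N] {b : Form1 d ℝ} (hb : IsAffine b) (a : Site d) :
    affineLift N (trans1 a b) = trans1 ((N : ℤ) • a) (affineLift N b) := by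
  obtain ⟨m, c, rfl⟩ := hb
  have hN : (N : ℝ) ≠ 0 := by exact_mod_cast NeZero.ne N
  -- the translate has the same linear part
  have hlinT : liftLin N (trans1 a (affine m c)) = liftLin N (affine m c) := by
    funext κ l
    simp only [liftLin, linPart, trans1_apply, affine, Pi.add_apply, Int.cast_add, mul_add,
      Finset.sum_add_distrib]
    ring
  -- and its constant part is shifted by `N^{-(d+1)} · (m a)`
  have hcst : liftCst N (trans1 a (affine m c))
      = liftCst N (affine m c) + fun κ => ((N : ℝ) ^ (d + 1))⁻¹ * ∑ l, m κ l * (a l : ℝ) := by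
    funext κ
    simp only [Pi.add_apply, liftCst, hlinT, cstPart, trans1_apply, affine, zero_add, Pi.zero_apply, Int.cast_zero,
      mul_zero, Finset.sum_const_zero]
    ring
  rw [affineLift, affineLift, hlinT, hcst, trans1_affine, affine_add_cst]
  congr 1
  funext κ
  simp only [Pi.add_apply]
  congr 1
  rw [Finset.mul_sum]
  refine Finset.sum_congr rfl fun l _ => ?_
  simp only [liftLin, linPart_affine, Pi.smul_apply, smul_eq_mul, Int.cast_mul, Int.cast_natCast]
  field_simp
  ring

/-! ## §3 The spec instance at every `N ≥ 1` -/

/-- `codiff₁ 0 = 0`. [folklore] -/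
theorem codiff₁_zero : codiff₁ (0 : Form1 d ℝ) = 0 := by
  funext x
  simp [codiff₁]

/-- **THE AFFINE-LIFT INSTANCE**: for every `d` and every `N ≥ 1`, `InfiniteVolumeSpec d N` is inhabited by
`H := affineLift N`, `Φ := 0`, `Ψ := 0`.  The type of the (O1′) hypothesis therefore carries no analytic content; see the
module docstring for what this means for the wall's records. [folklore] -/
def affineLiftSpec (d N : ℕ) [NeZero N] : InfiniteVolumeSpec d N where
  H := affineLift N
  Φ := fun _ => 0
  Ψ := fun _ => 0
  H_add := fun b b' _ _ => affineLift_add N b b'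
  Φ_add := fun _ _ _ _ => by simp
  Ψ_add := fun _ _ _ _ => by simp
  H_cov := fun b a hb => affineLift_trans1 N hb a
  Φ_cov := fun _ _ _ => rfl
  Ψ_cov := fun _ _ _ => rfl
  Q_H := fun b hb => contourSum_affineLift N hb
  EL := fun b _ => by
    rw [affineLift, curvAdj_curv_affine]
    funext κ x
    simp [contourSumAdj, dz]
  gauge := fun b _ => by
    rw [affineLift, codiff₁_affine_eq, dz_const, codiff₁_zero]
    exact fun _ _ _ => rfl

/-- The instance's `H` is the affine lift. [folklore] -/
theorem affineLiftSpec_H (d N : ℕ) [NeZero N] : (affineLiftSpec d N).H = affineLift N := rfl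

/-- The instance's multipliers vanish. [folklore] -/
theorem affineLiftSpec_Φ (d N : ℕ) [NeZero N] (b : Form1 d ℝ) : (affineLiftSpec d N).Φ b = 0 := rfl

end Literature.MathematicalPhysics.QuantumFieldTheory.Balaban1983to89.Beta.AffineLiftSpec
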